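import Mathlib.Combinatorics.SimpleGraph.Metric
import Mathlib.Data.Fintype.Card
import Mathlib.Data.Fintype.Prod
import Mathlib.Data.ZMod.Defs
import Mathlib.Algebra.BigOperators.Pi
import Mathlib.Algebra.Group.Pi.Lemmas
import Mathlib.Logic.Equiv.Fin.Rotate
import Mathlib.Algebra.Group.End
import Mathlib.Logic.Function.Basic
import HarnessLib

/-!
# k-pairs (multiple-unicast) networks, one-shot binary network codes, XOR networks

Statement-level vocabulary of network coding for the *k-pairs communication problem* on
directed acyclic networks, in the finite, alphabet-`{0,1}`, "one bit per arc" form in which it is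
consumed by circuit lower-bound arguments ([AfshaniEtAl2019] §2, §4;
[AdlerEtAl2006] §2; the undirected multiple-unicast conjecture of [LiLi2004]).

* `KPairsNet ι` — a finite acyclic directed MULTIgraph (arc type `A` with `src`/`tgt`, acyclicity
  carried by a rank function) with `ι`-indexed sources (in-degree `0`) and sinks (out-degree `0`);
  commodity `i` is to be sent from `source i` to `sink i` ([AfshaniEtAl2019] §2
  "k-pairs communication problem": "a directed acyclic graph … k sources … k sinks").
* `KPairsNet.Code N` — a *binary one-shot network code* on `N`: every arc carries ONE bit that is a
  function of the bits entering its tail (and of the source bit if the tail is a source), and every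
  sink decodes its own commodity, FOR ALL inputs ([AfshaniEtAl2019] §2 "network coding
  solution … correct if, for all inputs …", specialised to `Γ(e) = {0,1}` and unit-entropy sources —
  the case a Boolean circuit with arbitrary gates produces, ibid. §4). Stated by FUNCTIONAL
  DEPENDENCE (`local_`, `decode`) rather than by gate tables; the two are equivalent on a DAG.
* `KPairsNet.graph` (underlying undirected simple graph), `KPairsNet.Far L` (every source–sink pair
  at undirected distance `≥ L`, via `SimpleGraph.edist`, so an undirected-unreachable pair counts as
  far), `KPairsNet.DegLE Δ` (in- and out-degrees `≤ Δ`, parallel arcs counted), `KPairsNet.arcCount`.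
* `KPairsNet.rewire` / `KPairsNet.Code.rewire` — re-pairing and restriction of commodities along
  embeddings (the "hard-wire the other inputs" step of [AfshaniEtAl2019] §2, §4:
  dropped sources keep their arcs, which then carry constants).
* `KPairsNet.shiftNet`, `KPairsNet.RealizesAllShifts` — a wiring with `n` inputs and `n` outputs
  realises all cyclic shifts with re-programmable gates: for every `s` the pairing
  `input i ↦ output (i + s)` carries a binary one-shot code ([Riis2007] §4 p. 4 (information flow
  problem on an acyclic network with input/output nodes), §7–8 pp. 8–10 (Valiant's shift
  Conjectures 1', 2' and the shifted graph `G_s`); [Valiant1977]; [PudlakRodlSgall1997] §6 (shifts);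
  [Pippenger1990Networks] §2.4 (shifters)).
* `XorNet ι` — an XOR network (a linear circuit over `𝔽₂` read as a DAG: every non-source node
  carries the sum of its in-neighbours' labels, [JuknaBFC2012] §13.5 p. 382, eq. (13.2);
  sources carry the unit vectors) with, for each commodity, a designated node whose label is again
  that unit vector; `XorNet.graph/Far/DegLE/arcCount` as above.

Design choices. Commodities are indexed by an arbitrary type `ι` (not `Fin n`) so that restriction
to a sub-family is re-indexing along an embedding `κ ↪ ι` (`rewire`, `Code.restrict`); arcs form a
type with `src`/`tgt` (parallel arcs = parallel unit-capacity wires); acyclicity is a rank function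
(so "the bits entering the tail determine the arc's bit" is a well-founded circuit semantics). The
tree's `Literature.Barriers.PneNP.IONetwork` (simple digraph on `Fin n ⊕ …`, no acyclicity, no
commodity pairing, built for vertex-disjoint-path superconcentration) serves a different purpose and
is deliberately not reused.

What is NOT here: entropic rates / general alphabets (the conjecture of [LiLi2004] concerns
`H(Y_e) ≤ c(e)`; the binary class is the one closed under fixing source bits), multicommodity
flows, and any claim about these objects — this file is definitions plus the bookkeeping lemmas
`rewire_arcCount`, `rewire_degLE`, `rewire_graph` and the construction `Code.restrict`.
-/

namespace Literature.InformationTheory.NetworkCoding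

open Finset

/-- A **k-pairs network** (multiple-unicast instance on a DAG): a finite directed acyclic
multigraph — vertices `V`, arcs `A` with tail `src a` and head `tgt a`, acyclicity witnessed by a
rank function strictly increasing along arcs — with `ι`-indexed, pairwise distinct sources of
in-degree `0` and sinks of out-degree `0`; commodity `i` must travel from `source i` to `sink i`.
[cite: AfshaniEtAl2019, §2 (k-pairs communication problem)] -/
structure KPairsNet (ι : Type) where
  /-- The vertex type. -/
  V : Type
  /-- The arc type (parallel arcs allowed). -/
  A : Type
  /-- Vertices have decidable equality. -/
  [instDecEqV : DecidableEq V]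
  /-- Finitely many vertices. -/
  [instFintypeV : Fintype V]
  /-- Arcs have decidable equality. -/
  [instDecEqA : DecidableEq A]
  /-- Finitely many arcs. -/
  [instFintypeA : Fintype A]
  /-- Tail of an arc. -/
  src : A → V
  /-- Head of an arc. -/
  tgt : A → V
  /-- A rank function certifying acyclicity. -/
  rank : V → ℕ
  /-- Arcs strictly increase the rank. -/
  rank_lt : ∀ a, rank (src a) < rank (tgt a)
  /-- The sources, indexed by commodities. -/
  source : ι ↪ V
  /-- The sinks, indexed by commodities (`sink i` must recover commodity `i`). -/
  sink : ι ↪ V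
  /-- Sources have in-degree `0`. -/
  source_in : ∀ a i, tgt a ≠ source i
  /-- Sinks have out-degree `0`. -/
  sink_out : ∀ a i, src a ≠ sink i

namespace KPairsNet

variable {ι : Type} (N : KPairsNet ι)

/-- Decidable equality of vertices (bundled instance). [folklore] -/
instance : DecidableEq N.V := N.instDecEqV
/-- Finiteness of vertices (bundled instance). [folklore] -/
instance : Fintype N.V := N.instFintypeV
/-- Decidable equality of arcs (bundled instance). [folklore] -/
instance : DecidableEq N.A := N.instDecEqA
/-- Finiteness of arcs (bundled instance). [folklore] -/
instance : Fintype N.A := N.instFintypeA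

/-- The arcs entering `v`. [folklore] -/
def inArcs (v : N.V) : Finset N.A := univ.filter fun a => N.tgt a = v

/-- The arcs leaving `v`. [folklore] -/
def outArcs (v : N.V) : Finset N.A := univ.filter fun a => N.src a = v

/-- The number of arcs `m = |A|` (parallel arcs counted with multiplicity).
[cite: AfshaniEtAl2019, §4 (|E| with unit capacities)] -/
def arcCount : ℕ := Fintype.card N.A

/-- Every vertex has in-degree and out-degree at most `Δ` ("bounded in and out degrees").
[cite: AfshaniEtAl2019, Theorem 2] -/
def DegLE (Δ : ℕ) : Prop := ∀ v, (N.inArcs v).card ≤ Δ ∧ (N.outArcs v).card ≤ Δ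

/-- The underlying undirected simple graph ("making each directed edge undirected"; parallel arcs
merge, which does not change distances). [cite: AfshaniEtAl2019, §2 (the undirected graph G' of a k-pairs problem)] -/
def graph : SimpleGraph N.V := SimpleGraph.fromRel fun v w => ∃ a, N.src a = v ∧ N.tgt a = w

/-- Every source–sink pair is at undirected (extended) distance at least `L`; an undirected-unreachable
pair has `edist = ⊤` and counts as far. [cite: AfshaniEtAl2019, §4 (pairs at distance ≥ ½ log_c n)] -/
def Far (L : ℕ) : Prop := ∀ i, (L : ℕ∞) ≤ N.graph.edist (N.source i) (N.sink i)

/-- A **binary one-shot network code** on `N`: arc `a` carries the bit `val a x ∈ {0,1}` on input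
`x : ι → Bool`; LOCALITY: that bit is determined by the bits on the arcs entering the tail of `a`
together with the source bit sitting at the tail (if the tail is a source); DECODABILITY: for every
commodity `i` and ALL inputs, the bits entering `sink i` determine `x i`. (A network-coding solution
with every alphabet `{0,1}` and uniform-bit messages, i.e. rate `1` at unit capacities; functional
form of the gate/decoder tables.) [cite: AfshaniEtAl2019, §2 (network coding solution; correctness for all inputs)] -/
structure Code where
  /-- The bit carried by arc `a` on input `x`. -/
  val : N.A → (ι → Bool) → Bool
  /-- Locality at the tail: in-arc bits and the tail's own source bit determine the arc's bit. -/
  local_ : ∀ (a : N.A) (x x' : ι → Bool),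
    (∀ b, N.tgt b = N.src a → val b x = val b x') →
    (∀ i, N.source i = N.src a → x i = x' i) → val a x = val a x'
  /-- Decodability at every sink, for all inputs. -/
  decode : ∀ (i : ι) (x x' : ι → Bool), (∀ b, N.tgt b = N.sink i → val b x = val b x') → x i = x' i

/-- Re-pairing / restriction of commodities: keep the multigraph, take as sources the old sources
`e j` and as sinks the old sinks `f j` (`j : κ`). Dropped sources stay in the network as ordinary
in-degree-`0` vertices (their arcs will carry constants), dropped sinks as ordinary vertices; no arc
and no distance changes. [cite: AfshaniEtAl2019, §2 (hardwiring), §4] -/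
def rewire {κ : Type} (e f : κ ↪ ι) : KPairsNet κ where
  V := N.V
  A := N.A
  src := N.src
  tgt := N.tgt
  rank := N.rank
  rank_lt := N.rank_lt
  source := e.trans N.source
  sink := f.trans N.sink
  source_in a j := N.source_in a (e j)
  sink_out a j := N.sink_out a (f j)

/-- Re-pairing keeps the arc count. [folklore] -/
@[simp] theorem rewire_arcCount {κ : Type} (e f : κ ↪ ι) : (N.rewire e f).arcCount = N.arcCount := rfl

/-- Re-pairing keeps every degree bound. [folklore] -/
theorem rewire_degLE {κ : Type} (e f : κ ↪ ι) {Δ : ℕ} (h : N.DegLE Δ) : (N.rewire e f).DegLE Δ := h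

/-- Re-pairing keeps the underlying undirected graph (hence all distances). [folklore] -/
theorem rewire_graph {κ : Type} (e f : κ ↪ ι) : (N.rewire e f).graph = N.graph := rfl

namespace Code

variable {N}

/-- RESTRICTION of a code to a sub-family of commodities `e : κ ↪ ι` (each kept commodity keeps
its own source and sink): inputs of dropped commodities are hard-wired to `false`, so the arcs out of
dropped sources carry constants; arc bits stay bits and the multigraph is untouched.
[cite: AfshaniEtAl2019, §4 (hard-wire every input x_j, j ∉ J, to 0)] -/
noncomputable def restrict {κ : Type} (c : N.Code) (e : κ ↪ ι) : (N.rewire e e).Code where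
  val a y := c.val a (Function.extend e y fun _ => false)
  local_ a y y' hb hs := by
    refine c.local_ a _ _ hb ?_
    intro i hi
    by_cases h : ∃ j, e j = i
    · obtain ⟨j, rfl⟩ := h
      rw [e.injective.extend_apply, e.injective.extend_apply]
      exact hs j hi
    · rw [Function.extend_apply' _ _ _ h, Function.extend_apply' _ _ _ h]
  decode j y y' hb := by
    have key := c.decode (e j) _ _ hb
    rwa [e.injective.extend_apply, e.injective.extend_apply] at key

end Code

/-- The cyclic-shift instance on a wiring with `n` inputs and `n` outputs: commodity `i` goes from
input `i` to output `i + s` (indices mod `n`, via `finRotate`). [cite: Riis2007, §8 p. 10 (the graph G shifted by s); Valiant1977] -/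
def shiftNet {n : ℕ} (W : KPairsNet (Fin n)) (s : Fin n) : KPairsNet (Fin n) :=
  W.rewire (Function.Embedding.refl _) (((finRotate n) ^ (s : ℕ)).toEmbedding)

/-- A wiring (fixed acyclic topology, `n` inputs of in-degree `0`, `n` outputs of out-degree `0`)
**realises all cyclic shifts with re-programmable gates**: for every shift `s` some assignment of
Boolean functions to its arcs — a binary one-shot code for the pairing `i ↦ i + s` — lets output
`i + s` recover input bit `x_i`, for all inputs. [cite: Riis2007, §4 p. 4 (information flow problem: N can be turned into a circuit computing the prescribed outputs) and §8 p. 10 (the shifted graph G_s, all shifts s)] -/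
def RealizesAllShifts {n : ℕ} (W : KPairsNet (Fin n)) : Prop := ∀ s : Fin n, Nonempty (W.shiftNet s).Code

end KPairsNet

/-- An **XOR network** for commodities `ι`: a finite acyclic simple digraph in which source `i`
carries the unit vector `e_i ∈ 𝔽₂^ι` and every other node carries the SUM of the labels of its
in-neighbours (a linear circuit over `GF(2)` with unbounded fan-in XOR gates, read as its graph),
together with, for each `i`, a designated node `sink i` whose label is again `e_i` (it recomputes
`x_i`). The labelling is part of the data and pinned down by the two equations (it exists and is
unique on a DAG). [cite: JuknaBFC2012, §13.5 p. 382 (linear circuits: each non-input node computes the sum mod 2 of its inputs; eq. (13.2))] -/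
structure XorNet (ι : Type) [DecidableEq ι] where
  /-- The vertex type. -/
  V : Type
  /-- Vertices have decidable equality. -/
  [instDecEqV : DecidableEq V]
  /-- Finitely many vertices. -/
  [instFintypeV : Fintype V]
  /-- The arcs (no parallel arcs). -/
  Adj : V → V → Prop
  /-- Adjacency is decidable. -/
  [instDecRel : DecidableRel Adj]
  /-- A rank function certifying acyclicity. -/
  rank : V → ℕ
  /-- Arcs strictly increase the rank. -/
  rank_lt : ∀ v w, Adj v w → rank v < rank w
  /-- The sources, indexed by commodities. -/
  source : ι ↪ V
  /-- For each commodity a designated node recomputing it. -/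
  sink : ι → V
  /-- The `𝔽₂^ι`-label (the linear form of the inputs) carried by each node. -/
  label : V → ι → ZMod 2
  /-- Sources have in-degree `0`. -/
  source_in : ∀ v i, ¬ Adj v (source i)
  /-- Source `i` carries `e_i`. -/
  label_source : ∀ i, label (source i) = Pi.single i 1
  /-- A non-source carries the sum of its in-neighbours' labels. -/
  label_step : ∀ v, (∀ i, source i ≠ v) → label v = ∑ w ∈ Finset.univ.filter (fun w => Adj w v), label w
  /-- The designated node of commodity `i` carries `e_i`. -/
  label_sink : ∀ i, label (sink i) = Pi.single i 1

namespace XorNet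

variable {ι : Type} [DecidableEq ι] (P : XorNet ι)

/-- Decidable equality of vertices (bundled instance). [folklore] -/
instance : DecidableEq P.V := P.instDecEqV
/-- Finiteness of vertices (bundled instance). [folklore] -/
instance : Fintype P.V := P.instFintypeV
/-- Decidability of adjacency (bundled instance). [folklore] -/
instance : DecidableRel P.Adj := P.instDecRel

/-- The number of arcs. [folklore] -/
def arcCount : ℕ := (univ.filter fun p : P.V × P.V => P.Adj p.1 p.2).card

/-- In-degree and out-degree of every node at most `Δ`. [folklore] -/
def DegLE (Δ : ℕ) : Prop :=
  ∀ v, (univ.filter fun w => P.Adj w v).card ≤ Δ ∧ (univ.filter fun w => P.Adj v w).card ≤ Δ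

/-- The underlying undirected simple graph. [folklore] -/
def graph : SimpleGraph P.V := SimpleGraph.fromRel P.Adj

/-- Every commodity's designated node is at undirected (extended) distance `≥ L` from its source.
[folklore] -/
def Far (L : ℕ) : Prop := ∀ i, (L : ℕ∞) ≤ P.graph.edist (P.source i) (P.sink i)

end XorNet

end Literature.InformationTheory.NetworkCoding
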